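import Literature.AnabelianGeometry.EtaleTheta.ConstantsDictionary
import Literature.AnabelianGeometry.EtaleTheta.FrobenioidThetaOfThetaEnvData
import Literature.AnabelianGeometry.EtaleTheta.FrobenioidThetaToyData
import Literature.AnabelianGeometry.EtaleTheta.SettingModelKrullOpenSubgroups
import Mathlib.GroupTheory.SemidirectProduct

/-!
# [EtTh] §5 ↔ §3: a §5 datum over the setting's own §2 model with birational units `J_N^×` — the TERMS for the
# non-vacuity of `ConstantsDictionary` (Def. 3.6 (iii)/(iv) p. 304, Lemma 5.8 p. 331 / PDF pp. 78, 105)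

Mochizuki, *The étale theta function and its Frobenioid-theoretic manifestations*, Publ. RIMS **45** (2009)
[cite: MochizukiEtTh2009, Lem 5.8 p.331 (PDF p.105)].  abc-iut cell, layer L2, seat abc-iut-L2-t11 (gen 5); row
«NV-CONSTANTS-DICTIONARY» (census cell B10 «satisfiable», `plan/L2/VNEXT-CENSUS-L2.md`).  ADDITIVE: new TERMS only — a
toy §5 datum, its natural action, cyclotome identification and reading; no interface is edited, no instance / notation /
new `Prop` fact; everything of other seats is consumed BY NAME (abc-iut-L2-t4 `ThetaFrobenioid.ofThetaEnvData`,
abc-iut-L2-t8 `Cu.thetaEnvData μ hC hS`, abc-iut-f-117 `Toy.autEquiv/homOf/pre/stub`, this lineage's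
`ThetaSetting.isOpen_GJN`, abc-iut-L2-t1's `map_fieldJN_le`).  The THEOREM that the datum satisfies abc-iut-L2-t11's FROZEN
predicate `ThetaFrobenioid.BiratAutAction.ConstantsDictionary` (p439403) — generically and at the record model `modelχ` — is
the proof-only companion `Discharge/Sec5ConstantsDictionaryWitnessFacts.lean`.

WHAT IS BUILT (namespace `ThetaFrobenioid.CnstToy`), for a theta setting `D` (base field `K ⊆ ℚ̄_p`), an étale theta datum
`E`, a choice `X̲̲` (`Cu : E.DoubleUnderline l`), a level `N`, a cyclotome identification `μ` and the §1/§2 hypotheses `hC`,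
`hS` (so that abc-iut-L2-t8's model `T := Cu.thetaEnvData μ hC hS` of Def. 2.13 is available).  Print (Lemma 5.8, p. 331): the
constants of `B_N` form a finite extension of `K` containing `(K^×)^{1/N}` and `μ_N(B_N)`, on which "`Π^tp_Y` [i.e., `G_K`,
via the natural surjection `Π^tp_Y ↠ G_K`] acts".  We realise exactly this much:
* `J D N := J_N = K_N(a^{1/N})_{a ∈ K_N} ⊆ ℚ̄_p` (§1 p. 14; `fieldJN D.K D.qX N`) — contains `K`, `μ_N`, every `N`-th root of
  every element of `K`; `G_K`-stable; `restr : G_K → Aut(J_N/ℚ_p)` with image `Γ := Gam D N` ("`Aut_D(B_N^bs)`");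
* `Aut_C(B_N) := μ_N(J_N) ⋊ Γ` (`G D N`; `Γ` acts on `μ_N(J_N)` by the Galois action `phi`, so that conjugation by
  `s^⊓-gp_N(γ)` on a unit IS the Galois action, as the equivariance of "the natural inclusion `O^×(B_N) ↪ O^×(B_N^birat)`"
  demands) over the one-object base `SingleObj Γ` (`Toy.pre`, `Toy.stub`): units `O^×(B_N) = μ_N(J_N)`, birational units
  `O^×(B_N^birat) := J_N^×`, constants "`K^× ↪ O^×(B_N^birat)`" the inclusion `K^× ↪ J_N^×`;
* the §5 datum `datum Cu μ hC hS` `= ThetaFrobenioid.ofThetaEnvData …` over `T` ITSELF (`ι := refl`), with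
  `ρ := Γ-restriction ∘ (Π^tp_X̲̲ ↠ G_K)` — onto, with OPEN kernel since `Ker ρ ⊇ aug⁻¹(G_{J_N})` and `G_{J_N}` is open in the
  Krull topology (`ThetaSetting.isOpen_GJN`; this is where a FINITE field of constants is forced) — and `s^⊓-gp_N := inr`;
* "the natural action" `act` (abc-iut-L2-t11's `BiratAutAction`) of `Aut_C(B_N)` on `J_N^×` through `Γ`, with its three laws
  PROVED; the cyclotome identification `muEquiv : μ_N(B_N) ⥲ μ_N(ℚ̄_p) = T.mu`; the reading `reading : J_N^× ↪ ℚ̄_p^×`.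
HONEST LABEL: terms of a consistency / non-vacuity witness.  The datum is NOT the tempered Frobenioid of a curve (its
divisor monoids are trivial and `A_⊚ = A_N = B_N`); nothing of [EtTh] is asserted; typed ≠ proved; no side is taken on
anything downstream ([IUTchIII] Cor. 3.12).
-/

noncomputable section

namespace Literature.AnabelianGeometry.EtaleTheta

open CategoryTheory Literature.AnabelianGeometry.SemiGraphs IntermediateField

namespace ThetaFrobenioid

namespace CnstToy

variable {p : ℕ} [Fact p.Prime] (D : ThetaSetting p) (N : ℕ+)

/-! ### The field of constants `J_N` and the Galois image `Γ = Aut_D(B_N^bs)` -/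

/-- `J_N = K_N(a^{1/N})_{a ∈ K_N} ⊆ ℚ̄_p` (§1 p. 14 (PDF p. 14); Lemma 5.8 p. 331: a field of constants of `B_N` containing
`(K^×)^{1/N}` and `μ_N(B_N)`).  [cite: MochizukiEtTh2009, Lem 5.8 p.331 (PDF p.105)] -/
abbrev J : IntermediateField ℚ_[p] (PadicAlgCl p) := fieldJN D.K D.qX N

/-- `K ⊆ J_N`. [cite: MochizukiEtTh2009, §1 p.14] -/
theorem K_le_J : D.K ≤ J D N := (le_fieldKN D.K D.qX N).trans (fieldKN_le_fieldJN D.K D.qX N)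

/-- `G_K` stabilises `J_N` ("`Gal(K_N/K)`", p. 13; `map_fieldJN_le`). [cite: MochizukiEtTh2009, §1 p.14] -/
theorem smul_mem_J (σ : D.GK) {x : PadicAlgCl p} (hx : x ∈ J D N) : (σ : GQp p) x ∈ J D N :=
  map_fieldJN_le D.K D.qX D.qX_mem N σ σ.2 ⟨x, hx, rfl⟩

/-- **The restriction `G_K → Aut(J_N/ℚ_p)`** of the Galois action to the constants ("`Π^tp_Y` [i.e., `G_K`, via the natural
surjection `Π^tp_Y ↠ G_K`] acts", proof of Lemma 5.8).  [cite: MochizukiEtTh2009, Lem 5.8 proof p.331 (PDF p.105)] -/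
def restr : D.GK →* ((J D N) ≃ₐ[ℚ_[p]] (J D N)) where
  toFun σ :=
    { toFun := fun x => ⟨(σ : GQp p) x, smul_mem_J D N σ x.2⟩
      invFun := fun x => ⟨((σ⁻¹ : D.GK) : GQp p) x, smul_mem_J D N σ⁻¹ x.2⟩
      left_inv := fun x => Subtype.ext ((σ : GQp p).symm_apply_apply (x : PadicAlgCl p))
      right_inv := fun x => Subtype.ext ((σ : GQp p).apply_symm_apply (x : PadicAlgCl p))
      map_mul' := fun _ _ => Subtype.ext (map_mul (σ : GQp p) _ _)
      map_add' := fun _ _ => Subtype.ext (map_add (σ : GQp p) _ _)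
      commutes' := fun r => Subtype.ext ((σ : GQp p).commutes r) }
  map_one' := AlgEquiv.ext fun _ => rfl
  map_mul' _ _ := AlgEquiv.ext fun _ => rfl

/-- `restr σ` acts on `J_N ⊆ ℚ̄_p` by `σ`. [cite: MochizukiEtTh2009, Lem 5.8 proof p.331 (PDF p.105)] -/
@[simp] theorem coe_restr_apply (σ : D.GK) (x : J D N) :
    ((restr D N σ x : J D N) : PadicAlgCl p) = (σ : GQp p) x := rfl

/-- `Γ := Im(G_K → Aut(J_N/ℚ_p))` — the toy's "`Aut_D(B_N^bs)`" (Def. 4.1 (ii): the natural surjective outer homomorphism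
`Π^tp_X ↠ Aut_D(B_N^bs)`).  [cite: MochizukiEtTh2009, Def 4.1 (ii) p.313 (PDF p.87)] -/
abbrev Gam : Subgroup ((J D N) ≃ₐ[ℚ_[p]] (J D N)) := (restr D N).range

/-- `μ_N(J_N)`, the toy's "`μ_N(B_N) = O^×(B_N)`" ([FrdII] Def. 2.1 (i); Def. 5.4 p. 327).
[cite: MochizukiEtTh2009, Def 5.4 p.327 (PDF p.101)] -/
abbrev Mu : Type := rootsOfUnity N (J D N)

/-- `Γ` acts on `μ_N(J_N)` through the Galois action (the mod-`N` cyclotomic character read on `J_N`).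
[cite: MochizukiEtTh2009, Def 2.10 p.270 (PDF p.44)] -/
def phi : Gam D N →* MulAut (Mu D N) where
  toFun γ := ((γ : (J D N) ≃ₐ[ℚ_[p]] (J D N)).toRingEquiv.toMulEquiv).restrictRootsOfUnity N
  map_one' := by
    ext ζ
    rfl
  map_mul' γ γ' := by
    ext ζ
    rfl

/-- **`Aut_C(B_N) := μ_N(J_N) ⋊ Γ`**: units `μ_N(B_N)`, base automorphisms `Γ`, and conjugation by (a lift of) `γ ∈ Γ` acting
on the units by the Galois action — the shape in which "the natural inclusion `O^×(B_N) ↪ O^×(B_N^birat)`" (Lemma 5.8) can be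
`Aut_C(B_N)`-equivariant.  [cite: MochizukiEtTh2009, Lem 5.8 p.331 (PDF p.105)] -/
abbrev G : Type := Mu D N ⋊[phi D N] Gam D N

/-- `Aut_C(B_N) ↠ Aut_D(B_N^bs)`, the toy base projection. [cite: MochizukiEtTh2009, §5 p.331 (PDF p.105)] -/
abbrev π : G D N →* Gam D N := SemidirectProduct.rightHom

/-- `Ker(Aut_C(B_N) ↠ Aut_D(B_N^bs)) = μ_N(J_N)` is abelian ([FrdI] Rmk. 1.3.1). [cite: MochizukiEtTh2009, §5 p.331 (PDF p.105)] -/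
theorem comm_of_π (a b : G D N) (ha : π D N a = 1) (hb : π D N b = 1) : a * b = b * a := by
  change a.right = 1 at ha
  change b.right = 1 at hb
  refine SemidirectProduct.ext ?_ ?_
  · rw [SemidirectProduct.mul_left, SemidirectProduct.mul_left, ha, hb, map_one, MulAut.one_apply,
      MulAut.one_apply, mul_comm]
  · rw [SemidirectProduct.mul_right, SemidirectProduct.mul_right, ha, hb]

/-- Conjugating a unit `inl ζ` by `g ∈ Aut_C(B_N)` is the Galois action of `g^bs`: `g·inl(ζ)·g⁻¹ = inl(g^bs · ζ)`.
[cite: MochizukiEtTh2009, Lem 5.8 p.331 (PDF p.105)] -/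
theorem conj_inl (g : G D N) (ζ : Mu D N) :
    g * SemidirectProduct.inl ζ * g⁻¹ = SemidirectProduct.inl (phi D N g.right ζ) := by
  refine SemidirectProduct.ext ?_ ?_
  · simp only [SemidirectProduct.mul_left, SemidirectProduct.mul_right, SemidirectProduct.inv_left,
      SemidirectProduct.left_inl, SemidirectProduct.right_inl, mul_one, ← MulAut.mul_apply, ← map_mul,
      mul_inv_cancel, map_one, MulAut.one_apply]
    rw [mul_comm g.left, mul_assoc, mul_inv_cancel, mul_one]
  · simp only [SemidirectProduct.mul_right, SemidirectProduct.inv_right, SemidirectProduct.right_inl,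
      mul_one, mul_inv_cancel]

/-- `O^×(S) → μ_N(J_N)`, `u ↦ u.left` (a homomorphism on the `Ker π`-automorphisms): "the natural inclusion
`O^×(B_N) ↪ O^×(B_N^birat)`" of the toy, before composing with `μ_N(J_N) ⊆ J_N^×`.  [cite: MochizukiEtTh2009, Lem 5.8 p.331 (PDF p.105)] -/
def leftHom (S : SingleObj (G D N)) : (Toy.pre (π D N)).unitsSubgroup S →* Mu D N where
  toFun u := (Toy.homOf (G D N) S u).left
  map_one' := rfl
  map_mul' a b := by
    have ha : (Toy.homOf (G D N) S a).right = 1 := (Toy.mem_unitsSubgroup_pre_iff (π D N) S _).mp a.2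
    change (Toy.homOf (G D N) S (a.1 * b.1)).left = (Toy.homOf (G D N) S a).left * (Toy.homOf (G D N) S b).left
    rw [map_mul, SemidirectProduct.mul_left, ha, map_one, MulAut.one_apply]

/-- A unit of the toy is `inl` of its `μ_N(J_N)`-component. [cite: MochizukiEtTh2009, Lem 5.8 p.331 (PDF p.105)] -/
theorem homOf_eq_inl_leftHom (S : SingleObj (G D N)) (u : (Toy.pre (π D N)).unitsSubgroup S) :
    Toy.homOf (G D N) S u = SemidirectProduct.inl (leftHom D N S u) := by
  have hu : (Toy.homOf (G D N) S u).right = 1 := (Toy.mem_unitsSubgroup_pre_iff (π D N) S _).mp u.2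
  rw [← SemidirectProduct.inl_left_mul_inr_right (Toy.homOf (G D N) S u), hu, map_one, mul_one]
  rfl

/-- `u ↦ u.left` is injective on `O^×(S)`. [cite: MochizukiEtTh2009, Lem 5.8 p.331 (PDF p.105)] -/
theorem leftHom_injective (S : SingleObj (G D N)) : Function.Injective (leftHom D N S) := by
  intro a b h
  have h' : Toy.homOf (G D N) S a = Toy.homOf (G D N) S b := by
    rw [homOf_eq_inl_leftHom, homOf_eq_inl_leftHom, h]
  exact Subtype.ext (Toy.homOf_injective (G D N) S h')

/-- "The natural inclusion `O^×(S) ↪ O^×(S^birat)`" of the toy: `u ↦ u.left ∈ μ_N(J_N) ⊆ J_N^×`.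
[cite: MochizukiEtTh2009, Lem 5.8 p.331 (PDF p.105)] -/
abbrev unitsToBirat (S : SingleObj (G D N)) : (Toy.pre (π D N)).unitsSubgroup S →* (J D N)ˣ :=
  (rootsOfUnity N (J D N)).subtype.comp (leftHom D N S)

/-- `O^×(S) ↪ O^×(S^birat)` is injective. [cite: MochizukiEtTh2009, Lem 5.8 p.331 (PDF p.105)] -/
theorem unitsToBirat_injective (S : SingleObj (G D N)) : Function.Injective (unitsToBirat D N S) :=
  Subtype.val_injective.comp (leftHom_injective D N S)

/-- The toy tempered-Frobenioid stub: `Aut_C = μ_N(J_N) ⋊ Γ` over `Aut_D = Γ`, `O^× = μ_N(J_N)`, `O^×(−^birat) := J_N^×`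
(abc-iut-f-117's `Toy.stub`).  [cite: MochizukiEtTh2009, §5 p.322 (PDF p.96)] -/
abbrev stub : FrobenioidTheta.TemperedFrobenioidStub.{0} (SingleObj (G D N)) (SingleObj (Gam D N)) :=
  Toy.stub (π D N) (comm_of_π D N) ((J D N)ˣ) (unitsToBirat D N) (unitsToBirat_injective D N)

/-- The trivial subquotient stub `(l·Δ_Θ)_E := 1` over the toy base. [cite: MochizukiEtTh2009, §5 p.327 (PDF p.101)] -/
def subquot : FrobenioidTheta.ThetaSubquotientStub.{0} (SingleObj (Gam D N)) where
  lDelta _ := PUnit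
  lDeltaMap _ := 1

/-- "The natural inclusion `K^× ↪ O^×(B_N^birat)`" of the toy: `K^× ↪ J_N^×` (Lemma 5.8; Def. 3.6 (iii): the constants `K`).
[cite: MochizukiEtTh2009, Lem 5.8 p.331 (PDF p.105)] -/
abbrev constEmb : (D.K)ˣ →* (J D N)ˣ := Units.map (IntermediateField.inclusion (K_le_J D N)).toRingHom.toMonoidHom

/-- `K^× ↪ J_N^×` is injective. [cite: MochizukiEtTh2009, Lem 5.8 p.331 (PDF p.105)] -/
theorem constEmb_injective : Function.Injective (constEmb D N) :=
  Units.map_injective (IntermediateField.inclusion_injective (K_le_J D N))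

/-- An `N`-th root of unity of `ℚ̄_p` lies in `J_N` (indeed in `K_N = K(ζ_N, q^{1/N})`). [cite: MochizukiEtTh2009, §1 p.13] -/
theorem coe_MuN_mem_J (ζ : MuN p N) : (((ζ : (PadicAlgCl p)ˣ) : PadicAlgCl p)) ∈ J D N :=
  fieldKN_le_fieldJN D.K D.qX N (mem_fieldKN_of_pow_eq_one D.K D.qX (N := N)
    (by rw [← Units.val_pow_eq_pow_val, show (ζ : (PadicAlgCl p)ˣ) ^ (N : ℕ) = 1 from ζ.2, Units.val_one]))

/-- `μ_N(ℚ̄_p) → μ_N(J_N)`, the inverse identification on roots of unity. [cite: MochizukiEtTh2009, §1 p.13] -/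
def muOfMuN (ζ : MuN p N) : Mu D N :=
  ⟨Units.mk0 ⟨((ζ : (PadicAlgCl p)ˣ) : PadicAlgCl p), coe_MuN_mem_J D N ζ⟩
      (fun h => (ζ : (PadicAlgCl p)ˣ).ne_zero (congrArg Subtype.val h)), by
    rw [mem_rootsOfUnity]
    refine Units.ext (Subtype.ext ?_)
    change (((ζ : (PadicAlgCl p)ˣ) : PadicAlgCl p)) ^ (N : ℕ) = 1
    rw [← Units.val_pow_eq_pow_val, show (ζ : (PadicAlgCl p)ˣ) ^ (N : ℕ) = 1 from ζ.2, Units.val_one]⟩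

/-- **The reading `ν̃ : O^×(B_N^birat) = J_N^× ↪ ℚ̄_p^×`** of the constants in `ℚ̄_p` (Def. 3.6 (iv) "`C^{bs-fld}`": the base field
of `B_N` embedded in `ℚ̄_p` over `K`), on the whole group of birational units `Cst := ⊤`.
[cite: MochizukiEtTh2009, Def 3.6 (iv) p.304 (PDF p.78)] -/
def reading : (⊤ : Subgroup (J D N)ˣ) →* (PadicAlgCl p)ˣ :=
  (Units.map (algebraMap (J D N) (PadicAlgCl p)).toMonoidHom).comp (Subgroup.subtype ⊤)

/-! ### The §5 datum over the setting's own §2 model `T := Cu.thetaEnvData μ hC hS` -/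

variable {D N} {E : D.EtaleThetaData} {l : ℕ} (Cu : E.DoubleUnderline l) (μ : D.CyclotomeMod l N)
  (hC : D.Compat) (hS : D.Sec2Hyps)

/-- **`ρ : Π^tp_X̲̲ ↠ Aut_D(B_N^bs) = Γ`**: the augmentation `Π^tp_X̲̲ ↠ G_K` followed by the restriction to `J_N` ("the natural
[surjective] outer homomorphism `Π^tp_X ↠ Aut_D(B_N^bs)` [cf. Definition 4.1, (ii)]", p. 331).
[cite: MochizukiEtTh2009, §5 p.331 (PDF p.105)] -/
def rho : (Cu.thetaEnvData μ hC hS).PiX →* Aut (SingleObj.star (Gam D N)) :=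
  (Toy.autEquiv (Gam D N)).toMonoidHom.comp ((restr D N).rangeRestrict.comp (Cu.thetaEnvData μ hC hS).aug)

/-- `ρ` on elements. [cite: MochizukiEtTh2009, §5 p.331 (PDF p.105)] -/
theorem rho_apply (y : (Cu.thetaEnvData μ hC hS).PiX) :
    rho Cu μ hC hS y = Toy.autEquiv (Gam D N) ((restr D N).rangeRestrict ((Cu.thetaEnvData μ hC hS).aug y)) := rfl

/-- `ρ` is surjective (`Π^tp_X̲̲ ↠ G_K ↠ Γ`). [cite: MochizukiEtTh2009, Def 4.1 (ii) p.313 (PDF p.87)] -/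
theorem rho_surjective : Function.Surjective (rho Cu μ hC hS) :=
  (Toy.autEquiv (Gam D N)).surjective.comp
    ((MonoidHom.rangeRestrict_surjective _).comp (Cu.thetaEnvData μ hC hS).aug_surjective)

/-- **`Ker ρ` is open**: it contains `aug⁻¹(G_{J_N})`, and `G_{J_N}` is open in `G_{ℚ_p}` for the Krull topology
(`ThetaSetting.isOpen_GJN`: `J_N/ℚ_p` is finite) while `Π^tp_X̲̲ ↠ G_{ℚ_p}` is continuous.  This is where the finite field of
constants `J_N` (rather than all of `ℚ̄_p`) is forced.  [cite: MochizukiEtTh2009, §4 p.312 (PDF p.86)] -/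
theorem isOpen_ker_rho : IsOpen (((rho Cu μ hC hS).ker : Subgroup (Cu.thetaEnvData μ hC hS).PiX) :
    Set (Cu.thetaEnvData μ hC hS).PiX) := by
  let H : Subgroup (Cu.thetaEnvData μ hC hS).PiX := ((D.GJN N).comap D.aug.toMonoidHom).comap Cu.Huu.subtype
  have hH : IsOpen (H : Set (Cu.thetaEnvData μ hC hS).PiX) :=
    ((D.isOpen_GJN N).preimage (map_continuous D.aug)).preimage continuous_subtype_val
  refine Subgroup.isOpen_mono (H₁ := H) ?_ hH
  intro y hy
  rw [MonoidHom.mem_ker, rho_apply, MulEquiv.map_eq_one_iff]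
  apply Subtype.ext
  rw [MonoidHom.coe_rangeRestrict, OneMemClass.coe_one]
  refine AlgEquiv.ext fun x => Subtype.ext ?_
  have hy' : D.aug (y : D.PiTemp) ∈ D.GJN N := hy
  exact (IntermediateField.mem_fixingSubgroup_iff _ _).mp hy' _ x.2

/-- `s^⊓-gp_N := inr : Aut_D(B_N^bs) = Γ → Aut_C(B_N) = μ_N(J_N) ⋊ Γ`, the canonical splitting (the toy's "`s^⊓-gp_N`", p. 331).
[cite: MochizukiEtTh2009, §5 p.331 (PDF p.105)] -/
abbrev sgpCap : Aut (SingleObj.star (Gam D N)) →* Aut (SingleObj.star (G D N)) :=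
  (Toy.autEquiv (G D N)).toMonoidHom.comp (SemidirectProduct.inr.comp (Toy.autEquiv (Gam D N)).symm.toMonoidHom)

/-- **The §5 datum over the setting's own §2 model** (`ThetaFrobenioid.ofThetaEnvData`, abc-iut-L2-t4): `Π`-block `:= T`'s
(`Π^tp_X̲ := Π^tp_X̲̲ = Cu.Huu`, `Π^tp_Ÿ̲ := T.PiYdd`), `C := B(μ_N(J_N) ⋊ Γ)`, `D := BΓ`, `A_⊚ = A_N = B_N = ⋆`,
`s^⊓_N = s^⊔_N = id`, `ρ` as above, `s^trv_N := 1`, `s^⊓-gp_N := inr`, `s^⊔-gp_N := 1`, constants `K^× ↪ J_N^×`, `Θ̈ := 1`.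
[cite: MochizukiEtTh2009, §5 p.330–332 (PDF pp.104–106)] -/
def datum : ThetaFrobenioid.{0} (SingleObj (G D N)) (SingleObj (Gam D N)) where
  toTemperedFrobenioidStub := stub D N
  toThetaSubquotientStub := subquot D N
  l := l
  odd_l := Cu.l_odd
  N := N
  Acirc := SingleObj.star _
  AN := SingleObj.star _
  BN := SingleObj.star _
  sCap := 𝟙 _
  sCup := 𝟙 _
  base_map_sCap := rfl
  isPreStep_sCap := ⟨rfl, show IsIso ((Toy.pre (π D N)).base.map (𝟙 _)) from inferInstance⟩
  isPreStep_sCup := ⟨rfl, show IsIso ((Toy.pre (π D N)).base.map (𝟙 _)) from inferInstance⟩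
  PiX := (Cu.thetaEnvData μ hC hS).PiX
  zquot := (Cu.thetaEnvData μ hC hS).zquot
  zquot_surjective := (Cu.thetaEnvData μ hC hS).zquot_surjective
  PiYdd := (Cu.thetaEnvData μ hC hS).PiYdd
  PiYdd_le := (Cu.thetaEnvData μ hC hS).ker_zquot.symm ▸ (Cu.thetaEnvData μ hC hS).PiYdd_le
  relindex_PiYdd := by rw [(Cu.thetaEnvData μ hC hS).ker_zquot]; exact (Cu.thetaEnvData μ hC hS).index_PiYdd
  PiYdd_normal := (Cu.thetaEnvData μ hC hS).PiYdd_normal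
  isOpen_PiYdd := (Cu.thetaEnvData μ hC hS).PiYdd_open
  ρ := rho Cu μ hC hS
  ρ_surjective := rho_surjective Cu μ hC hS
  isOpen_ker_ρ := isOpen_ker_rho Cu μ hC hS
  strv := 1
  sgpCap := sgpCap (D := D) (N := N)
  sgpCup := 1
  K := D.K
  constEmb := constEmb D N
  constEmb_injective := constEmb_injective D N
  thetaFn := 1

/-- `O^×(B_N)` of the datum: the automorphisms over `Ker π`. [cite: MochizukiEtTh2009, §5 p.331 (PDF p.105)] -/
theorem mem_units_datum_iff (u : Aut (datum Cu μ hC hS).BN) :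
    u ∈ (datum Cu μ hC hS).units (datum Cu μ hC hS).BN ↔ (Toy.homOf (G D N) _ u).right = 1 :=
  Toy.mem_unitsSubgroup_pre_iff (π D N) _ u

/-- The `μ_N(J_N)`-component of a unit of the datum ("the natural inclusion `O^×(B_N) ↪ O^×(B_N^birat)`" before
`μ_N(J_N) ⊆ J_N^×`). [cite: MochizukiEtTh2009, Lem 5.8 p.331 (PDF p.105)] -/
abbrev ul (u : (datum Cu μ hC hS).units (datum Cu μ hC hS).BN) : Mu D N := leftHom D N (datum Cu μ hC hS).BN u

/-- A unit of the datum is `inl` of its `μ_N(J_N)`-component. [cite: MochizukiEtTh2009, Lem 5.8 p.331 (PDF p.105)] -/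
theorem homOf_unit (u : (datum Cu μ hC hS).units (datum Cu μ hC hS).BN) :
    Toy.homOf (G D N) _ (u : Aut (datum Cu μ hC hS).BN) = SemidirectProduct.inl (ul Cu μ hC hS u) :=
  homOf_eq_inl_leftHom D N _ u

/-- "The natural inclusion `O^×(B_N) ↪ O^×(B_N^birat)`" of the datum is `u ↦ u.left ∈ μ_N(J_N) ⊆ J_N^×`.
[cite: MochizukiEtTh2009, Lem 5.8 p.331 (PDF p.105)] -/
theorem unitsToBirat_datum (u : (datum Cu μ hC hS).units (datum Cu μ hC hS).BN) :
    (datum Cu μ hC hS).unitsToBirat (datum Cu μ hC hS).BN u = ((ul Cu μ hC hS u : Mu D N) : (J D N)ˣ) := rfl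

/-- Conjugation of a unit by `e ∈ Aut_C(B_N)` is the Galois action of `e^bs ∈ Γ` on its `μ_N(J_N)`-component.
[cite: MochizukiEtTh2009, Lem 5.8 p.331 (PDF p.105)] -/
theorem ul_conj (e : Aut (datum Cu μ hC hS).BN) (u : (datum Cu μ hC hS).units (datum Cu μ hC hS).BN) :
    ul Cu μ hC hS ⟨e * (u : Aut (datum Cu μ hC hS).BN) * e⁻¹,
        ((datum Cu μ hC hS).units_normal (datum Cu μ hC hS).BN).conj_mem _ u.2 e⟩ =
      phi D N (π D N (Toy.homOf (G D N) _ e)) (ul Cu μ hC hS u) := by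
  apply SemidirectProduct.inl_injective (N := Mu D N) (G := Gam D N) (φ := phi D N)
  rw [← homOf_unit]
  change Toy.homOf (G D N) _ (e * (u : Aut (datum Cu μ hC hS).BN) * e⁻¹) = _
  rw [map_mul, map_mul, map_inv, homOf_unit, conj_inl]
  rfl

/-! ### "The natural action" of `Aut_C(B_N)` on `O^×(B_N^birat) = J_N^×` and the cyclotome identification -/

/-- The action of `e ∈ Aut_C(B_N)` on `J_N^×` through `e^bs ∈ Γ ⊆ Aut(J_N/ℚ_p)`. [cite: MochizukiEtTh2009, Def 4.1 (iii) p.313 (PDF p.87)] -/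
abbrev actHom : Aut (datum Cu μ hC hS).BN →* MulAut (J D N)ˣ :=
  ((MulDistribMulAction.toMulAut ((J D N) ≃ₐ[ℚ_[p]] (J D N)) (J D N)ˣ).comp (Gam D N).subtype).comp
    ((π D N).comp (Toy.homOf (G D N) (datum Cu μ hC hS).BN))

/-- Equivariance of "the natural inclusion `O^×(B_N) ↪ O^×(B_N^birat)`": `e · u = e ∘ u ∘ e⁻¹` read in `J_N^×`
(conjugation in `μ_N(J_N) ⋊ Γ` is the Galois action, `ul_conj`).  [cite: MochizukiEtTh2009, Lem 5.8 p.331 (PDF p.105)] -/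
theorem actHom_unitsToBirat (e : Aut (datum Cu μ hC hS).BN) (u : (datum Cu μ hC hS).units (datum Cu μ hC hS).BN) :
    actHom Cu μ hC hS e ((datum Cu μ hC hS).unitsToBirat (datum Cu μ hC hS).BN u) =
      (datum Cu μ hC hS).unitsToBirat (datum Cu μ hC hS).BN ⟨e * (u : Aut (datum Cu μ hC hS).BN) * e⁻¹,
        ((datum Cu μ hC hS).units_normal (datum Cu μ hC hS).BN).conj_mem _ u.2 e⟩ := by
  simp only [unitsToBirat_datum, ul_conj]
  exact Units.ext rfl

/-- `O^×(B_N)` acts trivially on `O^×(B_N^birat)` (the action is one of `Aut_C(B_N)/O^×(B_N) = Γ`).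
[cite: MochizukiEtTh2009, Def 4.1 (iii) p.313 (PDF p.87)] -/
theorem actHom_units (u : (datum Cu μ hC hS).units (datum Cu μ hC hS).BN) :
    actHom Cu μ hC hS (u : Aut (datum Cu μ hC hS).BN) = 1 := by
  change MulDistribMulAction.toMulAut ((J D N) ≃ₐ[ℚ_[p]] (J D N)) (J D N)ˣ
    ((π D N (Toy.homOf (G D N) _ (u : Aut (datum Cu μ hC hS).BN)) : (J D N) ≃ₐ[ℚ_[p]] (J D N))) = 1
  rw [show π D N (Toy.homOf (G D N) _ (u : Aut (datum Cu μ hC hS).BN)) = 1 from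
    (mem_units_datum_iff Cu μ hC hS _).mp u.2, OneMemClass.coe_one, map_one]

/-- The constants `K^× ⊆ J_N^×` are fixed: `Γ` is an image of `G_K = Gal(ℚ̄_p/K)`.
[cite: MochizukiEtTh2009, Lem 5.8 p.331 (PDF p.105)] -/
theorem actHom_constEmb (e : Aut (datum Cu μ hC hS).BN) (k : (D.K)ˣ) :
    actHom Cu μ hC hS e ((datum Cu μ hC hS).constEmb k) = (datum Cu μ hC hS).constEmb k := by
  obtain ⟨σ, hσ⟩ := (π D N (Toy.homOf (G D N) _ e)).2
  refine Units.ext (Subtype.ext ?_)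
  change (((π D N (Toy.homOf (G D N) _ e) : (J D N) ≃ₐ[ℚ_[p]] (J D N))
    (IntermediateField.inclusion (K_le_J D N) (k : D.K)) : J D N) : PadicAlgCl p) = ((k : D.K) : PadicAlgCl p)
  exact (congrArg (fun γ : (J D N) ≃ₐ[ℚ_[p]] (J D N) =>
    ((γ (IntermediateField.inclusion (K_le_J D N) (k : D.K)) : J D N) : PadicAlgCl p)) hσ).symm.trans
    ((IntermediateField.mem_fixingSubgroup_iff _ _).mp σ.2 _ (k : D.K).2)

/-- **"The natural action" of `Aut_C(B_N)` on `O^×(B_N^birat) = J_N^×`** (abc-iut-L2-t11's hypothesis structure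
`BiratAutAction`, Def. 4.1 (iii)): `e` acts through `e^bs ∈ Γ ⊆ Aut(J_N/ℚ_p)`; units act trivially, the inclusion
`O^×(B_N) ↪ O^×(B_N^birat)` is equivariant (`ul_conj`), the constants `K^×` are fixed (`Γ` is an image of `G_K`).
[cite: MochizukiEtTh2009, Def 4.1 (iii) p.313 (PDF p.87)] -/
def act : (datum Cu μ hC hS).BiratAutAction where
  act := actHom Cu μ hC hS
  act_unitsToBirat := actHom_unitsToBirat Cu μ hC hS
  act_units := actHom_units Cu μ hC hS
  act_constEmb := actHom_constEmb Cu μ hC hS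

/-- The toy's cyclotome read in `ℚ̄_p`: `μ_N(B_N) → μ_N(J_N) → μ_N(ℚ̄_p)`, `u ↦ u.left ↦` itself.
[cite: MochizukiEtTh2009, Lem 5.9 (iv) p.332 (PDF p.106)] -/
def muHom : (datum Cu μ hC hS).muTorsion (datum Cu μ hC hS).BN (datum Cu μ hC hS).N →* MuN p N :=
  (restrictRootsOfUnity (algebraMap (J D N) (PadicAlgCl p)) N).comp
    ((leftHom D N (datum Cu μ hC hS).BN).comp (Subgroup.inclusion ((datum Cu μ hC hS).muTorsion_le_units _ _)))

/-- `autEquiv(inl ζ)` is an element of `μ_N(B_N)`, for every `ζ ∈ μ_N(J_N)`. [cite: MochizukiEtTh2009, Def 5.4 p.327 (PDF p.101)] -/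
theorem autEquiv_inl_mem_muTorsion (ζ : Mu D N) :
    Toy.autEquiv (G D N) (SemidirectProduct.inl ζ) ∈
      (datum Cu μ hC hS).muTorsion (datum Cu μ hC hS).BN (datum Cu μ hC hS).N := by
  refine ⟨(mem_units_datum_iff Cu μ hC hS _).mpr rfl, ?_⟩
  change Toy.autEquiv (G D N) (SemidirectProduct.inl ζ) ^ (N : ℕ) = 1
  rw [← map_pow, ← map_pow, show ζ ^ (N : ℕ) = 1 from Subtype.ext ζ.2, map_one, map_one]

/-- **`m : μ_N(B_N) ⥲ μ_N(ℚ̄_p) = T.mu`**, the identification of the §5 cyclotome of the datum with the §2 cyclotome of the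
setting's model (`u ↦ u.left ∈ μ_N(J_N) ⊆ μ_N(ℚ̄_p)`, a bijection since `μ_N(ℚ̄_p) ⊆ J_N`).
[cite: MochizukiEtTh2009, Lem 5.9 (iv) p.332 (PDF p.106)] -/
def muEquiv : (datum Cu μ hC hS).muTorsion (datum Cu μ hC hS).BN (datum Cu μ hC hS).N ≃* (Cu.thetaEnvData μ hC hS).mu :=
  MulEquiv.ofBijective (muHom Cu μ hC hS)
    ⟨fun a b h => by
        have h' : leftHom D N _ (Subgroup.inclusion ((datum Cu μ hC hS).muTorsion_le_units _ _) a) =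
            leftHom D N _ (Subgroup.inclusion ((datum Cu μ hC hS).muTorsion_le_units _ _) b) := by
          refine Subtype.ext (Units.ext (Subtype.ext ?_))
          exact congrArg (fun z : MuN p N => ((z : (PadicAlgCl p)ˣ) : PadicAlgCl p)) h
        exact Subgroup.inclusion_injective _ (leftHom_injective D N _ h'),
      fun ζ => ⟨⟨Toy.autEquiv (G D N) (SemidirectProduct.inl (muOfMuN D N ζ)),
        autEquiv_inl_mem_muTorsion Cu μ hC hS _⟩, Subtype.ext (Units.ext rfl)⟩⟩

end CnstToy

end ThetaFrobenioid

end Literature.AnabelianGeometry.EtaleTheta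

end
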